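import Literature.NumberTheory.EllipticCurves.ComplexMultiplicationBurungaleFlachDescentProofs
import Literature.NumberTheory.EllipticCurves.ComplexMultiplicationMaximalOrderProofs
import HarnessLib

/-!
# The CM isogeny `E ∼ E^{(d_K)}` over `ℚ`: the cases `j = 0`, `j = 8000`, transport along `j`,
# and the reduction of the remaining six `j` to six explicit curves

Family `bsd`, trunk T-ELLARITH. Sibling file (D-0014 append protocol) of
`Literature.NumberTheory.EllipticCurves.ComplexMultiplicationBurungaleFlachDescentProofs`, whose
named fact `Literature.NumberTheory.EllipticCurves.isIsogenous_quadraticTwist_cmFieldDiscr` — *an elliptic curve `E/ℚ` with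
`j(E) ∈ maximalCMJInvariants` (CM by the maximal order `𝓞_K`, `K = ℚ(√d_K)`) is `ℚ`-isogenous to
its quadratic twist `E^{(d_K)}`* (Burungale–Flach 2024, proof of Cor. 2: *"In our case `E_ε` is
isogenous to `E` (see [Milne 1972, Thm. 3])"*) — is the one genuinely CM input of the descent
`K → ℚ` in the tree's proof of bsd.S28 from Burungale–Flach's Corollary 1. That file proves the
case `j = 1728` (`d_K = -4`, where the twist is even `ℚ`-isomorphic to `E`). Here:

* **`j = 0` (`d_K = -3`), proved** (`isIsogenous_quadraticTwist_of_j_eq_zero`): on a short model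
  `E : y² = x³ + B` the twist by `-3` is `y² = x³ - 27B`, and `y² = x³ + B ~ y² = x³ - 27B`
  over `ℚ` for every `B ≠ 0` (`isIsogenous_mk_a₆`): Vélu's `3`-isogeny of `ThreeIsogeny` at
  `(m, s) = (0, B⁻¹)` is `y² = x³ + B⁻² → y² = x³ - 27B⁻²` (kernel `{O, (0, ±B⁻¹)}`), and twisting
  both sides by `B` (`IsIsogenous.quadraticTwist`, Cremona §3.9 "twisting commutes with
  isogenies") gives `y² = x³ + B → y² = x³ - 27B` (the twist of `y² = x³ + c` by `d` is
  `y² = x³ + d³c` on the nose, `quadraticTwist_mk_a₆`). This is the classical `3`-isogeny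
  `(x, y) ↦ ((x³ + 4B)/x², y(x³ - 8B)/x³)` with kernel `{O, (0, ±√B)}`, obtained here without a
  rational kernel point.
* **`j = 8000` (`d_K = -8`), proved** (`isIsogenous_quadraticTwist_of_j_eq_8000`): for
  `E₈ : y² = x³ + 4x² + 2x` (Silverman, *Advanced Topics*, App. A §3, row `D = -8`; conductor `256`)
  the explicit `2`-isogeny of `IsogenyTwoTorsionProofs` (Silverman *AEC* III.4.5) lands in
  `y² = x³ - 8x² + 8x = (u = 2) • E₈^{(-8)}` (`isIsogenous_cm8_quadraticTwist`), and the statement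
  passes to every curve with `j = 8000` by transport along `j`.
* **Transport along `j`** (`isIsogenous_quadraticTwist_of_j_eq`, for `j ≠ 0, 1728`): if
  `E ~ E^{(D)}` and `j(W) = j(E)` then `W ~ W^{(D)}`, since `C • W = E^{(d)}` for some `d ∈ ℚ^*`
  (`exists_variableChange_eq_quadraticTwist_of_j_eq`, Silverman *AEC* X.5.4), isogenies twist
  (`IsIsogenous.quadraticTwist`), twists compose (`quadraticTwist_quadraticTwist`) and commute with
  changes of variables (`quadraticTwist_smul`).
* **The remaining six `j`** (`d_K = -7, -11, -19, -43, -67, -163`) need a cyclic `ℚ`-isogeny of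
  prime degree `|d_K|` (the endomorphism `√d_K` composed with the twisting isomorphism), for which
  the tree has no constructor (its explicit isogenies, `IsogenyTwoTorsionProofs` and
  `ThreeIsogeny`, verify the homomorphism property on the chord–tangent law by certified
  polynomial identities, feasible for degree `2, 3` only). By transport they reduce to **one curve
  each**: the named fact `isIsogenous_quadraticTwist_cmFieldDiscr_models` records, for the six
  minimal CM curves of Silverman's table (*Advanced Topics*, App. A §3, second table:
  `y² + xy = x³ - x² - 2x - 1`, `y² + y = x³ - x² - 7x + 10`, `y² + y = x³ - 38x + 90`,
  `y² + y = x³ - 860x + 9707`, `y² + y = x³ - 7370x + 243528`,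
  `y² + y = x³ - 2174420x + 1234136692`; conductors `7², 11², 19², 43², 67², 163²`, Cremona
  p. 88), that each is `ℚ`-isogenous to its twist by `d_K` — the same printed theorem
  (Milne 1972, Thm. 3, through Burungale–Flach) specialised to six equations, hence not stronger
  than the fact it refines (`isIsogenous_quadraticTwist_cmFieldDiscr_models_of`).
* **Assembly**: `isIsogenous_quadraticTwist_cmFieldDiscr_of_models` (the fact from the six-curve
  residue: nine-way case split on `j`, the cases `0, 1728, 8000` proved, the other six transported
  from the models), and the level-4 forms of the descent and of bsd.S28,
  `BurungaleFlach2024_bsd_rat_of_bsd_cmField_of_level4`,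
  `bsdTriple_of_j_mem_maximalCMJInvariants_of_L_one_ne_zero_of_level4`.

## References

* A. Burungale, M. Flach, *The conjecture of Birch and Swinnerton-Dyer for certain elliptic curves
  with complex multiplication*, Camb. J. Math. 12 (2024), proof of Cor. 2 (arXiv p. 4).
* J. S. Milne, *On the arithmetic of abelian varieties*, Invent. Math. 17 (1972), Thm. 3.
* [SilvermanATAEC1994] J. H. Silverman, *Advanced Topics in the Arithmetic of Elliptic Curves*,
  GTM 151 (1994), App. A §3, second table (PDF p. 438 of the held copy): minimal
  Weierstrass equations of the CM curves over `ℚ`, rows `f = 1`.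
* [SilvermanAEC2009] J. H. Silverman, *The Arithmetic of Elliptic Curves*, 2nd ed. (2009),
  III.4 Example 4.5 (the `2`-isogeny), X.5 Prop. 5.4 and Cor. 5.4.1 (twists).
* [CremonaAlgorithms1997] J. E. Cremona, *Algorithms for Modular Elliptic Curves*, 2nd ed. (1997),
  §3.8 (Vélu), §3.9 (p. 87, "twisting commutes with isogenies"; p. 88, the table `(D, j, N)`).
-/

noncomputable section

open scoped Classical

open WeierstrassCurve

namespace Literature.NumberTheory.EllipticCurves

/-! ### Transport along `j` (`j ≠ 0, 1728`) -/

/-- **Transport of `E ~ E^{(D)}` along `j`.** Let `E/ℚ` be elliptic with `j(E) ≠ 0, 1728` and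
`ℚ`-isogenous to its quadratic twist `E^{(D)}`. Then every elliptic `W/ℚ` with `j(W) = j(E)` is
`ℚ`-isogenous to `W^{(D)}`: `C • W = E^{(d)}` for some `d ∈ ℚ^*` and change of variables `C`
(`exists_variableChange_eq_quadraticTwist_of_j_eq`, Silverman *AEC* X.5.4), and
`W ~ C • W = E^{(d)} ~ (E^{(D)})^{(d)} = (E^{(d)})^{(D)} = (C • W)^{(D)} = C' • W^{(D)} ~ W^{(D)}`
by `isIsogenous_smul`, `IsIsogenous.quadraticTwist` (Cremona §3.9: twisting commutes with
isogenies), `quadraticTwist_quadraticTwist`, `quadraticTwist_smul` and `isIsogenous_of_smul`.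
Silverman, *AEC*, X.5 Prop. 5.4, Cor. 5.4.1; Cremona, *Algorithms*, §3.9 (p. 87).
[cite: SilvermanAEC2009, X.5 Prop. 5.4 and Cor. 5.4.1] -/
theorem isIsogenous_quadraticTwist_of_j_eq {W E : WeierstrassCurve ℚ} [W.IsElliptic]
    [E.IsElliptic] (hj : W.j = E.j) (h0 : E.j ≠ 0) (h1728 : E.j ≠ 1728) {D : ℚ}
    (hE : IsIsogenous E (E.quadraticTwist D)) : IsIsogenous W (W.quadraticTwist D) := by
  obtain ⟨d, hd, C, hC⟩ := exists_variableChange_eq_quadraticTwist_of_j_eq hj h0 h1728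
  -- `W ~ C • W = E^{(d)}`
  have h1 : IsIsogenous W (E.quadraticTwist d) := hC ▸ isIsogenous_smul W C
  -- `E^{(d)} ~ (E^{(D)})^{(d)} = (E^{(d)})^{(D)}`
  have h2 : IsIsogenous (E.quadraticTwist d) ((E.quadraticTwist d).quadraticTwist D) := by
    have h := hE.quadraticTwist hd
    rwa [quadraticTwist_quadraticTwist, mul_comm, ← quadraticTwist_quadraticTwist] at h
  -- `(E^{(d)})^{(D)} = (C • W)^{(D)} = C' • W^{(D)} ~ W^{(D)}`
  have h3 : IsIsogenous ((E.quadraticTwist d).quadraticTwist D) (W.quadraticTwist D) := by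
    rw [← hC, quadraticTwist_smul]
    exact isIsogenous_of_smul _ _
  exact (h1.trans' h2).trans' h3

/-! ### The case `j = 0` (`d_K = -3`): `y² = x³ + B ~ y² = x³ - 27B` -/

/-- The twist of `y² = x³ + c` by `d` is `y² = x³ + d³c`, on the nose (`b₂ = b₄ = 0`,
`b₆ = 4c`). Silverman, *AEC*, X.5 Prop. 5.4(iii) (`j = 0`). [folklore] -/
theorem quadraticTwist_mk_a₆ (c d : ℚ) :
    (⟨0, 0, 0, 0, c⟩ : WeierstrassCurve ℚ).quadraticTwist d = ⟨0, 0, 0, 0, d ^ 3 * c⟩ := by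
  ext
  · rfl
  · simp [WeierstrassCurve.quadraticTwist, WeierstrassCurve.b₂]
  · rfl
  · simp [WeierstrassCurve.quadraticTwist, WeierstrassCurve.b₄]
  · simp only [WeierstrassCurve.quadraticTwist, WeierstrassCurve.b₆]
    ring

/-- **`y² = x³ + c ~ y² = x³ - 27c` over `ℚ`, for every `c ≠ 0`.** Vélu's `3`-isogeny of
`ThreeIsogeny` at `(m, s) = (0, c⁻¹)` is `y² = x³ + c⁻² → y² = x³ - 27c⁻²` over `ℚ` (rational
kernel `{O, (0, ±c⁻¹)}`; `Δ = -432c⁻⁴ ≠ 0`), and twisting both curves by `c`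
(`IsIsogenous.quadraticTwist`) gives `y² = x³ + c³c⁻² = x³ + c → y² = x³ - 27c`
(`quadraticTwist_mk_a₆`). This is the `3`-isogeny with kernel `{O, (0, ±√c)}`,
`(x, y) ↦ ((x³ + 4c)/x², y(x³ - 8c)/x³)`, whose kernel points are rational only when `c` is a
square. Vélu 1971; Cremona, *Algorithms*, §3.8, §3.9 (p. 87).
[cite: CremonaAlgorithms1997, §3.8 and §3.9 (p. 87)] -/
theorem isIsogenous_mk_a₆ {c : ℚ} (hc : c ≠ 0) :
    IsIsogenous (⟨0, 0, 0, 0, c⟩ : WeierstrassCurve ℚ) ⟨0, 0, 0, 0, -27 * c⟩ := by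
  -- Vélu at `(m, s) = (0, c⁻¹)`: `y² = x³ + c⁻² ~ y² = x³ - 27c⁻²`
  have hT : threeTorsionModel (0 : ℚ) c⁻¹ = ⟨0, 0, 0, 0, c⁻¹ ^ 2⟩ := by
    ext <;> simp [threeTorsionModel]
  have hT' : threeIsogenyCodomain (0 : ℚ) c⁻¹ = ⟨0, 0, 0, 0, -27 * c⁻¹ ^ 2⟩ := by
    ext <;> simp [threeIsogenyCodomain]
  have hΔ : (threeTorsionModel (0 : ℚ) c⁻¹).Δ ≠ 0 := by
    have h' : (16 : ℚ) * c⁻¹ ^ 3 * (4 * 0 ^ 3 - 27 * c⁻¹) = -432 * c⁻¹ ^ 4 := by ring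
    rw [Δ_threeTorsionModel, h']
    exact mul_ne_zero (by norm_num) (pow_ne_zero _ (inv_ne_zero hc))
  have h1 := isIsogenous_threeTorsionModel_threeIsogenyCodomain hΔ
  rw [hT, hT'] at h1
  -- twist both sides by `c`
  have h2 := h1.quadraticTwist hc
  rw [quadraticTwist_mk_a₆, quadraticTwist_mk_a₆] at h2
  convert h2 using 2 <;> field_simp

/-- **The case `j = 0` of `isIsogenous_quadraticTwist_cmFieldDiscr`, proved.** An elliptic curve
`E/ℚ` with `j(E) = 0` (CM by `ℤ[ζ₃]`, `d_K = -3`) is `ℚ`-isogenous to its twist by `-3`: on a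
short model `S = C • E : y² = x³ + Ax + B` one has `A = 0` (`j = 6912A³/(4A³ + 27B²) = 0`) and
`B ≠ 0`, the twist is `S^{(-3)} : y² = x³ - 27B` (Silverman *AEC* X.5.4(i),
`quadraticTwist_of_isShortNF`), `S ~ S^{(-3)}` by `isIsogenous_mk_a₆`, and the isogeny is
transported along `E ≅ S` and `S^{(-3)} = (C • E)^{(-3)} = C' • E^{(-3)} ≅ E^{(-3)}`
(`isIsogenous_smul`, `quadraticTwist_smul`, `isIsogenous_of_smul`). Burungale–Flach, proof of
Cor. 2; Cremona, *Algorithms*, §3.8–3.9. [cite: BurungaleFlach2024, proof of Cor. 2 (arXiv p. 4)] -/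
theorem isIsogenous_quadraticTwist_of_j_eq_zero (W : WeierstrassCurve ℚ) [W.IsElliptic]
    (hj : W.j = 0) : IsIsogenous W (W.quadraticTwist (-3)) := by
  -- a short model `S = C • W : y² = x³ + A x + B`, with `A = 0`, `B ≠ 0`
  obtain ⟨C, hC⟩ := W.exists_variableChange_isShortNF
  haveI := hC
  have hjS : (C • W).j = 0 := by rw [variableChange_j]; exact hj
  have hden := four_mul_a₄_cube_add_ne_zero (C • W)
  have hA : (C • W).a₄ = 0 := by
    have hj' := (C • W).j_of_isShortNF
    rw [hjS, eq_comm, div_eq_zero_iff] at hj'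
    rcases hj' with h | h
    · exact pow_eq_zero_iff (n := 3) (by norm_num) |>.mp (by linarith [h])
    · exact absurd h hden
  have hB : (C • W).a₆ ≠ 0 := by
    intro hB
    apply hden
    rw [hA, hB]; ring
  have hS : C • W = ⟨0, 0, 0, 0, (C • W).a₆⟩ := by
    ext
    · exact a₁_of_isShortNF _
    · exact a₂_of_isShortNF _
    · exact a₃_of_isShortNF _
    · exact hA
    · rfl
  have htw : (C • W).quadraticTwist (-3) = ⟨0, 0, 0, 0, -27 * (C • W).a₆⟩ := by
    rw [quadraticTwist_of_isShortNF, hA]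
    ext <;> norm_num
  -- `W ~ S ~ S^{(-3)} = C' • W^{(-3)} ~ W^{(-3)}`
  have h1 : IsIsogenous W (C • W) := isIsogenous_smul W C
  have h2 : IsIsogenous (C • W) ((C • W).quadraticTwist (-3)) := by
    rw [htw]
    nth_rewrite 1 [hS]
    exact isIsogenous_mk_a₆ hB
  have h3 : IsIsogenous ((C • W).quadraticTwist (-3)) (W.quadraticTwist (-3)) := by
    rw [quadraticTwist_smul]
    exact isIsogenous_of_smul _ _
  exact (h1.trans' h2).trans' h3

/-! ### The case `j = 8000` (`d_K = -8`) -/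

/-- `E₈ : y² = x³ + 4x² + 2x`, the minimal CM curve with `D = -8` of Silverman's table
(*Advanced Topics*, App. A §3; `Δ = 2⁹`, conductor `2⁸`). [cite: SilvermanATAEC1994, App. A §3 (second table, row D = -8)] -/
abbrev cm8 : WeierstrassCurve ℚ := ⟨0, 4, 0, 2, 0⟩

/-- `E₈` is elliptic (`Δ = 512`). [folklore] -/
instance isElliptic_cm8 : cm8.IsElliptic :=
  (isElliptic_mk_twoTorsion_iff _ _).mpr (by norm_num)

/-- `j(E₈) = 8000 = 20³`. Silverman, *Advanced Topics*, App. A §3; Cremona, *Algorithms*, p. 88.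
[folklore] -/
theorem j_cm8 : cm8.j = 8000 := by
  show (⟨0, 4, 0, 2, 0⟩ : WeierstrassCurve ℚ).j = 8000
  rw [j_mk_twoTorsion]; norm_num

/-- **`E₈ ~ E₈^{(-8)}`**: the explicit `2`-isogeny `y² = x³ + 4x² + 2x → y² = x³ - 8x² + 8x`
(Silverman *AEC* III.4.5, kernel `{O, (0,0)}`) followed by the isomorphism
`y² = x³ - 8x² + 8x = (u = 2) • E₈^{(-8)}` (`E₈^{(-8)} = [0, -32, 0, 128, 0]`).
[cite: SilvermanAEC2009, III.4 Example 4.5] -/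
theorem isIsogenous_cm8_quadraticTwist : IsIsogenous cm8 (cm8.quadraticTwist (-8)) := by
  have h1 : IsIsogenous cm8 ⟨0, -8, 0, 8, 0⟩ :=
    isIsogenous_of_eq_twoIsogenyCodomain _ (by rw [twoIsogenyCodomain_mk]; norm_num)
  have h2 : (⟨Units.mk0 (2 : ℚ) (by norm_num), 0, 0, 0⟩ : VariableChange ℚ) •
      cm8.quadraticTwist (-8) = ⟨0, -8, 0, 8, 0⟩ := by
    ext
    · simp [variableChange_a₁]
    · simp [cm8, variableChange_a₂, WeierstrassCurve.quadraticTwist, WeierstrassCurve.b₂]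
      norm_num
    · simp [variableChange_a₃]
    · simp [cm8, variableChange_a₄, WeierstrassCurve.quadraticTwist, WeierstrassCurve.b₂,
        WeierstrassCurve.b₄]
      norm_num
    · simp [variableChange_a₆, WeierstrassCurve.quadraticTwist, WeierstrassCurve.b₂,
        WeierstrassCurve.b₄, WeierstrassCurve.b₆]
  exact h1.trans' (isIsogenous_of_smul_eq' h2)

/-- **The case `j = 8000` of `isIsogenous_quadraticTwist_cmFieldDiscr`, proved.** An elliptic
curve `E/ℚ` with `j(E) = 8000` (CM by `ℤ[√-2]`, `d_K = -8`) is `ℚ`-isogenous to its twist by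
`-8`: `isIsogenous_cm8_quadraticTwist` transported along `j` (`isIsogenous_quadraticTwist_of_j_eq`).
[cite: BurungaleFlach2024, proof of Cor. 2 (arXiv p. 4)] -/
theorem isIsogenous_quadraticTwist_of_j_eq_8000 (W : WeierstrassCurve ℚ) [W.IsElliptic]
    (hj : W.j = 8000) : IsIsogenous W (W.quadraticTwist (-8)) :=
  isIsogenous_quadraticTwist_of_j_eq (E := cm8) (by rw [hj, j_cm8])
    (by rw [j_cm8]; norm_num) (by rw [j_cm8]; norm_num) isIsogenous_cm8_quadraticTwist

/-! ### The six remaining CM curves (Silverman, *Advanced Topics*, App. A §3, rows `f = 1`) -/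

/-- `E₇ : y² + xy = x³ - x² - 2x - 1` (`D = -7`, `j = -3375 = -15³`, conductor `7²`).
[cite: SilvermanATAEC1994, App. A §3 (second table, row D = -7)] -/
abbrev cm7 : WeierstrassCurve ℚ := ⟨1, -1, 0, -2, -1⟩

/-- `E₁₁ : y² + y = x³ - x² - 7x + 10` (`D = -11`, `j = -32768 = -32³`, conductor `11²`).
[cite: SilvermanATAEC1994, App. A §3 (second table, row D = -11)] -/
abbrev cm11 : WeierstrassCurve ℚ := ⟨0, -1, 1, -7, 10⟩

/-- `E₁₉ : y² + y = x³ - 38x + 90` (`D = -19`, `j = -884736 = -96³`, conductor `19²`).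
[cite: SilvermanATAEC1994, App. A §3 (second table, row D = -19)] -/
abbrev cm19 : WeierstrassCurve ℚ := ⟨0, 0, 1, -38, 90⟩

/-- `E₄₃ : y² + y = x³ - 860x + 9707` (`D = -43`, `j = -884736000 = -960³`, conductor `43²`).
[cite: SilvermanATAEC1994, App. A §3 (second table, row D = -43)] -/
abbrev cm43 : WeierstrassCurve ℚ := ⟨0, 0, 1, -860, 9707⟩

/-- `E₆₇ : y² + y = x³ - 7370x + 243528` (`D = -67`, `j = -147197952000 = -5280³`, conductor
`67²`). [cite: SilvermanATAEC1994, App. A §3 (second table, row D = -67)] -/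
abbrev cm67 : WeierstrassCurve ℚ := ⟨0, 0, 1, -7370, 243528⟩

/-- `E₁₆₃ : y² + y = x³ - 2174420x + 1234136692` (`D = -163`,
`j = -262537412640768000 = -640320³`, conductor `163²`).
[cite: SilvermanATAEC1994, App. A §3 (second table, row D = -163)] -/
abbrev cm163 : WeierstrassCurve ℚ := ⟨0, 0, 1, -2174420, 1234136692⟩

/-- `Δ(E₇) = -7³`. [folklore] -/
theorem Δ_cm7 : cm7.Δ = -7 ^ 3 := by
  norm_num [cm7, WeierstrassCurve.Δ, WeierstrassCurve.b₂, WeierstrassCurve.b₄,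
    WeierstrassCurve.b₆, WeierstrassCurve.b₈]

/-- `Δ(E₁₁) = -11³`. [folklore] -/
theorem Δ_cm11 : cm11.Δ = -11 ^ 3 := by
  norm_num [cm11, WeierstrassCurve.Δ, WeierstrassCurve.b₂, WeierstrassCurve.b₄,
    WeierstrassCurve.b₆, WeierstrassCurve.b₈]

/-- `Δ(E₁₉) = -19³`. [folklore] -/
theorem Δ_cm19 : cm19.Δ = -19 ^ 3 := by
  norm_num [cm19, WeierstrassCurve.Δ, WeierstrassCurve.b₂, WeierstrassCurve.b₄,
    WeierstrassCurve.b₆, WeierstrassCurve.b₈]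

/-- `Δ(E₄₃) = -43³`. [folklore] -/
theorem Δ_cm43 : cm43.Δ = -43 ^ 3 := by
  norm_num [cm43, WeierstrassCurve.Δ, WeierstrassCurve.b₂, WeierstrassCurve.b₄,
    WeierstrassCurve.b₆, WeierstrassCurve.b₈]

/-- `Δ(E₆₇) = -67³`. [folklore] -/
theorem Δ_cm67 : cm67.Δ = -67 ^ 3 := by
  norm_num [cm67, WeierstrassCurve.Δ, WeierstrassCurve.b₂, WeierstrassCurve.b₄,
    WeierstrassCurve.b₆, WeierstrassCurve.b₈]

/-- `Δ(E₁₆₃) = -163³`. [folklore] -/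
theorem Δ_cm163 : cm163.Δ = -163 ^ 3 := by
  norm_num [cm163, WeierstrassCurve.Δ, WeierstrassCurve.b₂, WeierstrassCurve.b₄,
    WeierstrassCurve.b₆, WeierstrassCurve.b₈]

/-- `E₇` is elliptic. [folklore] -/
instance isElliptic_cm7 : cm7.IsElliptic := by
  rw [WeierstrassCurve.isElliptic_iff, Δ_cm7, isUnit_iff_ne_zero]; norm_num

/-- `E₁₁` is elliptic. [folklore] -/
instance isElliptic_cm11 : cm11.IsElliptic := by
  rw [WeierstrassCurve.isElliptic_iff, Δ_cm11, isUnit_iff_ne_zero]; norm_num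

/-- `E₁₉` is elliptic. [folklore] -/
instance isElliptic_cm19 : cm19.IsElliptic := by
  rw [WeierstrassCurve.isElliptic_iff, Δ_cm19, isUnit_iff_ne_zero]; norm_num

/-- `E₄₃` is elliptic. [folklore] -/
instance isElliptic_cm43 : cm43.IsElliptic := by
  rw [WeierstrassCurve.isElliptic_iff, Δ_cm43, isUnit_iff_ne_zero]; norm_num

/-- `E₆₇` is elliptic. [folklore] -/
instance isElliptic_cm67 : cm67.IsElliptic := by
  rw [WeierstrassCurve.isElliptic_iff, Δ_cm67, isUnit_iff_ne_zero]; norm_num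

/-- `E₁₆₃` is elliptic. [folklore] -/
instance isElliptic_cm163 : cm163.IsElliptic := by
  rw [WeierstrassCurve.isElliptic_iff, Δ_cm163, isUnit_iff_ne_zero]; norm_num

/-- `j` of an elliptic curve over `ℚ` as `c₄³/Δ` with `Δ` a field element (auxiliary).
Silverman, *AEC*, III.1. [folklore] -/
theorem j_eq_c₄_pow_div (W : WeierstrassCurve ℚ) [W.IsElliptic] : W.j = W.c₄ ^ 3 / W.Δ := by
  rw [WeierstrassCurve.j, Units.val_inv_eq_inv_val, WeierstrassCurve.coe_Δ', div_eq_inv_mul]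

/-- `j(E₇) = -3375 = -15³`. Cremona, *Algorithms*, p. 88. [folklore] -/
theorem j_cm7 : cm7.j = -3375 := by
  rw [j_eq_c₄_pow_div, Δ_cm7]
  norm_num [cm7, WeierstrassCurve.c₄, WeierstrassCurve.b₂, WeierstrassCurve.b₄]

/-- `j(E₁₁) = -32768 = -32³`. Cremona, *Algorithms*, p. 88. [folklore] -/
theorem j_cm11 : cm11.j = -32768 := by
  rw [j_eq_c₄_pow_div, Δ_cm11]
  norm_num [cm11, WeierstrassCurve.c₄, WeierstrassCurve.b₂, WeierstrassCurve.b₄]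

/-- `j(E₁₉) = -884736 = -96³`. Cremona, *Algorithms*, p. 88. [folklore] -/
theorem j_cm19 : cm19.j = -884736 := by
  rw [j_eq_c₄_pow_div, Δ_cm19]
  norm_num [cm19, WeierstrassCurve.c₄, WeierstrassCurve.b₂, WeierstrassCurve.b₄]

/-- `j(E₄₃) = -884736000 = -960³`. Cremona, *Algorithms*, p. 88. [folklore] -/
theorem j_cm43 : cm43.j = -884736000 := by
  rw [j_eq_c₄_pow_div, Δ_cm43]
  norm_num [cm43, WeierstrassCurve.c₄, WeierstrassCurve.b₂, WeierstrassCurve.b₄]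

/-- `j(E₆₇) = -147197952000 = -5280³`. Cremona, *Algorithms*, p. 88. [folklore] -/
theorem j_cm67 : cm67.j = -147197952000 := by
  rw [j_eq_c₄_pow_div, Δ_cm67]
  norm_num [cm67, WeierstrassCurve.c₄, WeierstrassCurve.b₂, WeierstrassCurve.b₄]

/-- `j(E₁₆₃) = -262537412640768000 = -640320³`. Cremona, *Algorithms*, p. 88. [folklore] -/
theorem j_cm163 : cm163.j = -262537412640768000 := by
  rw [j_eq_c₄_pow_div, Δ_cm163]
  norm_num [cm163, WeierstrassCurve.c₄, WeierstrassCurve.b₂, WeierstrassCurve.b₄]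

/-! ### The residual named fact: six explicit CM curves are isogenous to their twists -/

/-- **The six-curve residue of `isIsogenous_quadraticTwist_cmFieldDiscr`.** Each of the six
minimal CM curves `E_D` of Silverman's table with `D = d_K ∈ {-7, -11, -19, -43, -67, -163}`
(*Advanced Topics*, App. A §3, second table, rows `f = 1`: `y² + xy = x³ - x² - 2x - 1`,
`y² + y = x³ - x² - 7x + 10`, `y² + y = x³ - 38x + 90`, `y² + y = x³ - 860x + 9707`,
`y² + y = x³ - 7370x + 243528`, `y² + y = x³ - 2174420x + 1234136692`) is isogenous over `ℚ`
to its quadratic twist by `d_K`. This is Burungale–Flach's *"`E_ε` is isogenous to `E`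
(see [Milne 1972, Thm. 3])"* (proof of Cor. 2, `ε` the character of `K/ℚ`) for these six
equations, each of which has CM by `𝓞_K`, `K = ℚ(√D)` (loc. cit.); the isogeny is
`[√d_K] ∈ End_K(E)` composed with the `K`-isomorphism `E ≅ E^{(d_K)}`, cyclic of prime degree
`|d_K|` over `ℚ` (conductors `D²`; Cremona, *Algorithms*, p. 88, table `(D, j, N)`).
Together with the proved cases `j = 0, 1728, 8000` and transport along `j` it is equivalent to
`isIsogenous_quadraticTwist_cmFieldDiscr` (`…_of_models`, `…_models_of`); it is kept as a named
fact because the tree's explicit-isogeny constructors (`IsogenyTwoTorsionProofs`, `ThreeIsogeny`)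
cover degrees `2` and `3` only.
[cite: BurungaleFlach2024, proof of Cor. 2 (arXiv p. 4)]
[cite: Milne1972ArithmeticAV, Thm. 3 (through BurungaleFlach2024)]
[cite: SilvermanATAEC1994, App. A §3 (second table, rows f = 1)] -/
def isIsogenous_quadraticTwist_cmFieldDiscr_models : Prop :=
  IsIsogenous cm7 (cm7.quadraticTwist (-7)) ∧ IsIsogenous cm11 (cm11.quadraticTwist (-11)) ∧
    IsIsogenous cm19 (cm19.quadraticTwist (-19)) ∧ IsIsogenous cm43 (cm43.quadraticTwist (-43)) ∧
    IsIsogenous cm67 (cm67.quadraticTwist (-67)) ∧ IsIsogenous cm163 (cm163.quadraticTwist (-163))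

/-- The six-curve residue is a special case of `isIsogenous_quadraticTwist_cmFieldDiscr` (so it
is not stronger than the fact it refines). [cite: BurungaleFlach2024, proof of Cor. 2 (arXiv p. 4)] -/
theorem isIsogenous_quadraticTwist_cmFieldDiscr_models_of
    (h : isIsogenous_quadraticTwist_cmFieldDiscr) :
    isIsogenous_quadraticTwist_cmFieldDiscr_models := by
  refine ⟨?_, ?_, ?_, ?_, ?_, ?_⟩
  · have h' := h cm7 (by rw [j_cm7]; decide)
    have hd : (cmFieldDiscr cm7.j : ℚ) = -7 := by rw [j_cm7]; norm_num [cmFieldDiscr]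
    rwa [hd] at h'
  · have h' := h cm11 (by rw [j_cm11]; decide)
    have hd : (cmFieldDiscr cm11.j : ℚ) = -11 := by rw [j_cm11]; norm_num [cmFieldDiscr]
    rwa [hd] at h'
  · have h' := h cm19 (by rw [j_cm19]; decide)
    have hd : (cmFieldDiscr cm19.j : ℚ) = -19 := by rw [j_cm19]; norm_num [cmFieldDiscr]
    rwa [hd] at h'
  · have h' := h cm43 (by rw [j_cm43]; decide)
    have hd : (cmFieldDiscr cm43.j : ℚ) = -43 := by rw [j_cm43]; norm_num [cmFieldDiscr]
    rwa [hd] at h'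
  · have h' := h cm67 (by rw [j_cm67]; decide)
    have hd : (cmFieldDiscr cm67.j : ℚ) = -67 := by rw [j_cm67]; norm_num [cmFieldDiscr]
    rwa [hd] at h'
  · have h' := h cm163 (by rw [j_cm163]; decide)
    have hd : (cmFieldDiscr cm163.j : ℚ) = -163 := by rw [j_cm163]; norm_num [cmFieldDiscr]
    rwa [hd] at h'

/-- **`isIsogenous_quadraticTwist_cmFieldDiscr` from the six-curve residue.** Nine-way case
split on `j ∈ maximalCMJInvariants`: `j = 0` (`isIsogenous_quadraticTwist_of_j_eq_zero`),
`j = 1728` (`isIsogenous_quadraticTwist_cmFieldDiscr_of_j_eq`), `j = 8000`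
(`isIsogenous_quadraticTwist_of_j_eq_8000`) are proved; for the other six `j` the isogeny of the
model curve `E_D ~ E_D^{(D)}` is transported along `j` (`isIsogenous_quadraticTwist_of_j_eq`).
[cite: BurungaleFlach2024, proof of Cor. 2 (arXiv p. 4)] -/
theorem isIsogenous_quadraticTwist_cmFieldDiscr_of_models
    (h : isIsogenous_quadraticTwist_cmFieldDiscr_models) :
    isIsogenous_quadraticTwist_cmFieldDiscr := by
  obtain ⟨h7, h11, h19, h43, h67, h163⟩ := h
  intro W _ hj
  have hj' := hj
  simp only [maximalCMJInvariants, Finset.mem_insert, Finset.mem_singleton] at hj'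
  rcases hj' with h | h | h | h | h | h | h | h | h
  · have hd : (cmFieldDiscr W.j : ℚ) = -3 := by rw [h]; norm_num [cmFieldDiscr]
    rw [hd]
    exact isIsogenous_quadraticTwist_of_j_eq_zero W h
  · exact isIsogenous_quadraticTwist_cmFieldDiscr_of_j_eq W h
  · have hd : (cmFieldDiscr W.j : ℚ) = -7 := by rw [h]; norm_num [cmFieldDiscr]
    rw [hd]
    exact isIsogenous_quadraticTwist_of_j_eq (E := cm7) (by rw [h, j_cm7])
      (by rw [j_cm7]; norm_num) (by rw [j_cm7]; norm_num) h7
  · have hd : (cmFieldDiscr W.j : ℚ) = -8 := by rw [h]; norm_num [cmFieldDiscr]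
    rw [hd]
    exact isIsogenous_quadraticTwist_of_j_eq_8000 W h
  · have hd : (cmFieldDiscr W.j : ℚ) = -11 := by rw [h]; norm_num [cmFieldDiscr]
    rw [hd]
    exact isIsogenous_quadraticTwist_of_j_eq (E := cm11) (by rw [h, j_cm11])
      (by rw [j_cm11]; norm_num) (by rw [j_cm11]; norm_num) h11
  · have hd : (cmFieldDiscr W.j : ℚ) = -19 := by rw [h]; norm_num [cmFieldDiscr]
    rw [hd]
    exact isIsogenous_quadraticTwist_of_j_eq (E := cm19) (by rw [h, j_cm19])
      (by rw [j_cm19]; norm_num) (by rw [j_cm19]; norm_num) h19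
  · have hd : (cmFieldDiscr W.j : ℚ) = -43 := by rw [h]; norm_num [cmFieldDiscr]
    rw [hd]
    exact isIsogenous_quadraticTwist_of_j_eq (E := cm43) (by rw [h, j_cm43])
      (by rw [j_cm43]; norm_num) (by rw [j_cm43]; norm_num) h43
  · have hd : (cmFieldDiscr W.j : ℚ) = -67 := by rw [h]; norm_num [cmFieldDiscr]
    rw [hd]
    exact isIsogenous_quadraticTwist_of_j_eq (E := cm67) (by rw [h, j_cm67])
      (by rw [j_cm67]; norm_num) (by rw [j_cm67]; norm_num) h67
  · have hd : (cmFieldDiscr W.j : ℚ) = -163 := by rw [h]; norm_num [cmFieldDiscr]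
    rw [hd]
    exact isIsogenous_quadraticTwist_of_j_eq (E := cm163) (by rw [h, j_cm163])
      (by rw [j_cm163]; norm_num) (by rw [j_cm163]; norm_num) h163

/-! ### Level-4 assemblies -/

/-- **Burungale–Flach's descent from its standard inputs, level 4**: as
`BurungaleFlach2024_bsd_rat_of_bsd_cmField_of_level3`, with the CM isogeny input reduced to the
six-curve residue `isIsogenous_quadraticTwist_cmFieldDiscr_models` (the cases `j = 0, 1728, 8000`
being proved). [cite: BurungaleFlach2024, proof of Cor. 2 (arXiv p. 4)] -/
theorem BurungaleFlach2024_bsd_rat_of_bsd_cmField_of_level4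
    (hmod : hasEntireLFunction_rat) (hBCL : LSeries_baseChange_quadratic)
    (hBC : bsdRHS_baseChange_quadratic) (hISO : bsdRHS_eq_of_isIsogenous)
    (hKn : LFunction_eq_of_isIsogenous) (hPOS : re_entireLFunction_one_nonneg)
    (hTW₆ : isIsogenous_quadraticTwist_cmFieldDiscr_models) :
    BurungaleFlach2024_bsd_rat_of_bsd_cmField :=
  BurungaleFlach2024_bsd_rat_of_bsd_cmField_of_level3 hmod hBCL hBC hISO hKn hPOS
    (isIsogenous_quadraticTwist_cmFieldDiscr_of_models hTW₆)

/-- **bsd.S28 (verbatim form), level 4**: `bsdTriple_of_j_mem_maximalCMJInvariants_of_L_one_ne_zero`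
from Burungale–Flach's Corollary 1 over the CM field (`h₁`), modularity (`hmod`), Artin
formalism (`hBCL`), Milne's theorem on Weil restriction in quotient form (`hBC`), Cassels'
isogeny invariance (`hISO`), Knapp 11.67 (`hKn`), `L(E,1) ≥ 0` (`hPOS`) and the six-curve
residue of the CM isogeny (`hTW₆`); class number one, global minimal models over a PID, the
period and descent bookkeeping and the CM isogeny for `j = 0, 1728, 8000` being proved.
[cite: BurungaleFlach2024, Thm 1.1, Cor. 1, Cor. 2 (arXiv pp. 3–4)] -/
theorem bsdTriple_of_j_mem_maximalCMJInvariants_of_L_one_ne_zero_of_level4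
    (h₁ : BurungaleFlach2024_bsd_cmField)
    (hmod : hasEntireLFunction_rat) (hBCL : LSeries_baseChange_quadratic)
    (hBC : bsdRHS_baseChange_quadratic) (hISO : bsdRHS_eq_of_isIsogenous)
    (hKn : LFunction_eq_of_isIsogenous) (hPOS : re_entireLFunction_one_nonneg)
    (hTW₆ : isIsogenous_quadraticTwist_cmFieldDiscr_models) :
    bsdTriple_of_j_mem_maximalCMJInvariants_of_L_one_ne_zero :=
  bsdTriple_of_j_mem_maximalCMJInvariants_of_L_one_ne_zero_of_level3 h₁ hmod hBCL hBC hISO hKn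
    hPOS (isIsogenous_quadraticTwist_cmFieldDiscr_of_models hTW₆)

end Literature.NumberTheory.EllipticCurves

end
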